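import Summits.ResolutionOfSingularities.ResolutionOfSingularities.Theorems.HilbertSamuelEliminationSigmaMaxModificationsCorridor3WLadderIsoTailsHSArcCompletion
import Summits.ResolutionOfSingularities.ResolutionOfSingularities.Theorems.HilbertSamuelEliminationSigmaMaxModificationsCorridor3WLadderIsolatedCompletion
import Summits.ResolutionOfSingularities.ResolutionOfSingularities.Theorems.HilbertSamuelEliminationSigmaMaxModificationsCorridor3WLadderIsoTailsHSTower
import Summits.ResolutionOfSingularities.ResolutionOfSingularities.Theorems.HilbertSamuelEliminationSigmaMaxModificationsCorridor3OriginAscent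
import Summits.ResolutionOfSingularities.ResolutionOfSingularities.Theorems.HilbertSamuelEliminationSigmaMaxModificationsCorridor3WLadderLocalTower
import Literature.AlgebraicGeometry.CossartJannsenSaito2020.BlowupTowerLocalizeTransfer
import Literature.AlgebraicGeometry.Resolution.HilbertSamuelSemicontinuitySharp
import Summits.ResolutionOfSingularities.ResolutionOfSingularities.Theorems.HilbertSamuelEliminationSigmaMaxModificationsCorridor3WLadderIsoTailsFormalFrameAssembly
import Literature.AlgebraicGeometry.Resolution.RegularSystemOfParameters
import HarnessLib

/-!
# [OURS · L1 W4.2] D14 ROUTE H — **H∞-FINAL (binder form)**: an isolated point tower whose stage `n₀` is a HYPERSURFACE singularity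
# admits NO osculating formal arc of multiplicity `m` — the contradiction between H7∞ (the arc lies in the Hilbert–Samuel stratum of the
# completion) and H8 (isolation passes to the completion)
# (crux `SigmaMaxModifications` stmt-ResolutionOfSingularities-18506 / conjunct stmt-…-19249; kernel K1 `IsoFreeRationalTailsImpossible`,
# row `stub_WtopRecIsoM_pointed`; res-L1-w42-lead-1 REVISED WORD 12:02:43Z «001 := H∞-FINAL»)

Prover res-type-001 (gen 8). Helper file `--supports stmt-ResolutionOfSingularities-19249 --as helper`; kernel only, no definitions, no named
fact. OURS (cell res-hironaka, slot W4.2); NOT statements of [Hironaka2017] nor of [CossartJannsenSaito2020] / [CossartPiltant2009]. AI-written;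
AI review is weaker than expert review.

## What is proved

* `one_le_of_presentation` — bookkeeping: a hypersurface presentation `σ : R ↠ 𝒪`, `ker σ = (h)`, `h ∉ 𝔪^{m+1}` of a NONTRIVIAL ring has
  `m ≥ 1`.
* `isIsolatedInHSMaxLocus_spec_stalk_of_isIsoPointTower` — along an isolated point tower over a maximal origin (`IsIsoPointTower 3 ν T pt`,
  `IsMaximalOrigin p 3 ν (T.X 0) (pt 0)`), the closed point of `Spec 𝒪_{X_n, x_n}` is isolated in the Hilbert–Samuel locus (every stage is a
  maximal origin — `IsIsoPointTower.isMaximalOrigin` —, hence of finite type over a field, so `H` is upper semicontinuous along generizations,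
  `Scheme.hsFun_le_hsFun_of_specializes_over_field`; then res-type-053's `BlowupTower.isIsolatedInHSMaxLocus_localize` on the constant tower).
* **`false_of_isIsoPointTower_of_hypersurfaceStage_of_arc`** — H∞ in BINDER form. Data: the tower as above; a stage `n₀` whose local ring is
  presented as a hypersurface, `σ : R ↠ 𝒪_{X_{n₀},x_{n₀}}` with `R` regular local of embedding dimension `4`, `ker σ = (h)`,
  `h ∈ 𝔪^m ∖ 𝔪^{m+1}` (res-type-071's H4 currency); and THE ARC in the output shape of the frame tower (res-D-pv-010's
  `exists_frameTower_arc` / res-type-001's ring-level `mem_pow_arcIdeal_of_ringTower` + res-type-038's base frame): Cohen coordinates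
  `Ψ : κ⟦X₀..X₃⟧ ≃+* R̂`, the base frame `ψ₀` with `Ψ ∘ ψ₀ = (R → R̂)`, constants `c` and `ψ₀ h ∈ (X 1 − tSeries c₁, X 2 − tSeries c₂,
  X 3 − tSeries c₃)^m`. Conclusion: `False` — res-D-pv-010's H8 `IdeasL1C4.isIsolatedInHSMaxLocus_adicCompletion_of_ringEquiv` (excellent stalk,
  `dim ≤ 3`, presentation) makes the closed point of `Spec 𝒪̂` isolated, res-type-001's H7∞ `not_isIsolatedInHSMaxLocus_adicCompletion_of_frameTowerArc`
  (p525298) says it is not.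
* rev 2 **`false_of_isIsoPointTower_of_freeRationalTail_of_hypersurfaceStage`** — THE K1 HYPERSURFACE CELL: the arc binder discharged by
  res-D-pv-010's tower extraction `FormalFrame.exists_frameTower_arc_of_charP` (p531930) on the shifted tower `T.drop n₀`: a free-rational tail
  from a hypersurface stage (presentation adapted to the tail, (FREE)₀ at index `0`) is impossible.
* rev 3 **`false_of_isIsoPointTower_of_freeRationalTail_of_hypersurfacePresentation`** — the same from a BARE presentation
  (`R`, `CharP R p`, `emb.dim R = 4`, `σ`, `ker σ = (h)`, `h ∈ 𝔪^m ∖ 𝔪^{m+1}`): the coordinates and the exceptional index are produced inside.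

[OURS · L1 W4.2; AI-written]
-/

set_option linter.dupNamespace false

noncomputable section

open CategoryTheory AlgebraicGeometry TopologicalSpace IsLocalRing MvPowerSeries
open Literature.AlgebraicGeometry.Resolution Literature.RingTheory.HilbertSamuel
open Literature.AlgebraicGeometry.CossartJannsenSaito2020
open Summit.ResolutionOfSingularities.ResolutionOfSingularities.Theorems.CampaignW42
open Summit.ResolutionOfSingularities.ResolutionOfSingularities.Theorems.SigmaMaxModificationsCorridor3
open Summit.ResolutionOfSingularities.ResolutionOfSingularities.Cruxes.SigmaMaxModifications
open Summit.ResolutionOfSingularities.ResolutionOfSingularities.Cruxes.SigmaMaxModifications.IdeasL1C4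
open Summit.ResolutionOfSingularities.ResolutionOfSingularities.Cruxes.SigmaMaxModifications.IdeasL1Idea2R4

namespace Summit.ResolutionOfSingularities.ResolutionOfSingularities.Theorems.SigmaMaxModificationsCorridor3.IsoTailsHS

universe u

/-- Bookkeeping: a hypersurface presentation `σ : R ↠ A` with `ker σ = (h)` and `h ∉ 𝔪^{m+1}` of a nontrivial ring `A` has `m ≥ 1`
(for `m = 0`, `h` would be a unit and `A = 0`). [folklore] -/
theorem one_le_of_presentation {R A : Type u} [CommRing R] [IsLocalRing R] [CommRing A] [Nontrivial A] (σ : R →+* A)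
    {h : R} (hker : RingHom.ker σ = Ideal.span {h}) {m : ℕ} (hh : h ∉ maximalIdeal R ^ (m + 1)) : 1 ≤ m := by
  by_contra hm
  have hm0 : m = 0 := by omega
  subst hm0
  rw [zero_add, pow_one] at hh
  have hu : IsUnit h := not_not.mp fun hnu => hh ((IsLocalRing.mem_maximalIdeal h).mpr hnu)
  have h1 : (1 : R) ∈ RingHom.ker σ := by
    rw [hker, Ideal.span_singleton_eq_top.mpr hu]
    exact Submodule.mem_top
  exact one_ne_zero ((map_one σ).symm.trans ((RingHom.mem_ker).mp h1))

/-- **Isolation in `Spec 𝒪_{X_n,x_n}` along an isolated point tower over a maximal origin.** Every stage is a maximal origin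
(`IsIsoPointTower.isMaximalOrigin`), in particular of finite type over a field, so `H^N` is upper semicontinuous along the generizations of
`x_n` (`Scheme.hsFun_le_hsFun_of_specializes_over_field`) and the tower's isolation of `x_n` in `(X_n)_max` passes to the closed point of
`Spec 𝒪_{X_n,x_n}` (res-type-053's `BlowupTower.isIsolatedInHSMaxLocus_localize`, on the constant tower). [OURS · L1 W4.2; AI-written]
[cite: CossartJannsenSaito2020, Def. 13.3, Thm. 2.33 (1)] -/
theorem isIsolatedInHSMaxLocus_spec_stalk_of_isIsoPointTower {p : ℕ} {ν : ℕ → ℕ} {T : BlowupTower.{u}} {pt : ∀ n, T.X n}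
    (hO : IsMaximalOrigin p 3 ν (T.X 0) (pt 0)) (hT : IsIsoPointTower 3 ν T pt) (n : ℕ) :
    @IsIsolatedInHSMaxLocus (Spec ((T.X n).presheaf.stalk (pt n)))
      (by haveI : IsLocallyNoetherian (T.X n) := T.ln n; exact inferInstance) 3
      (closedPoint ((T.X n).presheaf.stalk (pt n))) := by
  haveI : IsLocallyNoetherian (T.X n) := T.ln n
  have hOn : IsMaximalOrigin p 3 ν (T.X n) (pt n) := hT.isMaximalOrigin hO n
  obtain ⟨k, _, _, f, -, hft, -⟩ := hOn.exists_structure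
  haveI := hft
  have hsc : ∀ y : T.X n, y ⤳ pt n → Scheme.hsFun (T.X n) 3 y ≤ Scheme.hsFun (T.X n) 3 (pt n) :=
    fun y hy => Scheme.hsFun_le_hsFun_of_specializes_over_field f 3 hy
  let T₀ : BlowupTower.{u} :=
    { X := fun _ => T.X n, ln := fun _ => T.ln n, C := fun _ => ∅, isClosed_C := fun _ => isClosed_empty,
      π := fun _ => 𝟙 (T.X n), isBlowup := fun _ => Moving.isBlowup_id_vanishingIdeal_empty (T.X n) }
  exact T₀.isIsolatedInHSMaxLocus_localize (pt n) 3 hsc (hT.2.2.2.2.1 n)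

/-- **H∞-FINAL (binder form): NO OSCULATING ARC AT A HYPERSURFACE STAGE OF AN ISOLATED POINT TOWER.** Let `(T, pt)` be an isolated
point tower at level `3` over a maximal origin of characteristic `p` (`H^3 ≡ ν`, every `x_n` isolated in `(X_n)_max`, `ē ≥ 3`), and let the
stage `n₀` be a hypersurface singularity: `σ : R ↠ 𝒪_{X_{n₀},x_{n₀}}`, `R` regular local of embedding dimension `4`, `ker σ = (h)`,
`h ∈ 𝔪^m ∖ 𝔪^{m+1}`. Then there are NO Cohen coordinates `Ψ : κ⟦X₀, …, X₃⟧ ≃+* R̂`, base frame `ψ₀` (`Ψ ∘ ψ₀ = (R → R̂)`) and constants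
`c` with `ψ₀ h ∈ (X 1 − Σ_k c_{k,1} t^k, X 2 − Σ_k c_{k,2} t^k, X 3 − Σ_k c_{k,3} t^k)^m` — the output of the frame tower of a free-rational
tail (lead-1's `mem_pow_of_frameTower`, res-D-pv-010's `exists_frameTower_arc`, res-type-001's `mem_pow_arcIdeal_of_ringTower`). Proof: H8
(`IdeasL1C4.isIsolatedInHSMaxLocus_adicCompletion_of_ringEquiv`: the stalk is excellent of dimension `≤ 3` and presented as `R/(h)`) makes the
closed point of `Spec 𝒪̂` isolated in the Hilbert–Samuel locus; H7∞ (`not_isIsolatedInHSMaxLocus_adicCompletion_of_frameTowerArc`) says the arc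
point lies in its stratum. [OURS · L1 W4.2; AI-written] [cite: CossartJannsenSaito2020, Def. 13.3] [cite: CossartPiltant2009, ch. 3 I.9] -/
theorem false_of_isIsoPointTower_of_hypersurfaceStage_of_arc {p : ℕ} {ν : ℕ → ℕ} {T : BlowupTower.{u}} {pt : ∀ n, T.X n}
    (hO : IsMaximalOrigin p 3 ν (T.X 0) (pt 0)) (hT : IsIsoPointTower 3 ν T pt) (n₀ : ℕ)
    {R : Type u} [CommRing R] [IsRegularLocalRing R] (hd : (maximalIdeal R).spanFinrank = 4)
    (σ : R →+* (T.X n₀).presheaf.stalk (pt n₀)) (hσ : Function.Surjective σ) {h : R}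
    (hker : RingHom.ker σ = Ideal.span {h}) {m : ℕ} (hh : h ∉ maximalIdeal R ^ (m + 1))
    {κ : Type u} [Field κ] (Ψ : MvPowerSeries (Fin 4) κ ≃+* AdicCompletion (maximalIdeal R) R)
    (ψ₀ : R →+* MvPowerSeries (Fin 4) κ) (hψ₀ : ∀ r, Ψ (ψ₀ r) = algebraMap R (AdicCompletion (maximalIdeal R) R) r)
    (c : ℕ → Fin 4 → κ)
    (hhP : ψ₀ h ∈ (Ideal.span ({X 1 - IdeasL1C5.Series.tSeries (fun k => c k 1), X 2 - IdeasL1C5.Series.tSeries (fun k => c k 2),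
      X 3 - IdeasL1C5.Series.tSeries (fun k => c k 3)} : Set (MvPowerSeries (Fin 4) κ))) ^ m) :
    False := by
  haveI : IsLocallyNoetherian (T.X n₀) := T.ln n₀
  -- the stalk at stage `n₀`: local, Noetherian, excellent, of dimension `≤ 3`
  have hexc : Scheme.IsExcellent (T.X n₀) := isExcellent_X T (isExcellent_of_isMaximalOrigin hO) n₀
  have hA : IsExcellentRing ((T.X n₀).presheaf.stalk (pt n₀)) := isExcellentRing_stalk_of_isExcellent hexc (pt n₀)
  have hdim : ringKrullDim ((T.X n₀).presheaf.stalk (pt n₀)) ≤ ((3 : ℕ) : WithBot ℕ∞) :=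
    ringKrullDim_stalk_le T hO.dim_le n₀ (pt n₀)
  have hm : 1 ≤ m := one_le_of_presentation σ hker hh
  -- H8: isolation at `x_{n₀}` passes to `Spec 𝒪̂`
  have hiso := isIsolatedInHSMaxLocus_spec_stalk_of_isIsoPointTower hO hT n₀
  obtain ⟨e⟩ := nonempty_ringEquiv_quotient_span_of_surjective σ hσ hker
  have hisoC := isIsolatedInHSMaxLocus_adicCompletion_of_ringEquiv ((T.X n₀).presheaf.stalk (pt n₀)) hA
    (Ideal.span {h}) e 3 hdim hiso
  -- H7∞: the arc lies in the Hilbert–Samuel stratum of the closed point of `Spec 𝒪̂`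
  exact not_isIsolatedInHSMaxLocus_adicCompletion_of_frameTowerArc hd σ hσ hker hm hh Ψ ψ₀ hψ₀ c hhP (le_refl 3) hisoC

/-! ## rev 2 — H∞-FINAL: the arc binder discharged by res-D-pv-010's tower extraction `FormalFrame.exists_frameTower_arc_of_charP`
(p531930, G1a-2 of record) — the K1 HYPERSURFACE CELL -/

/-- **H∞-FINAL — K1 AT A HYPERSURFACE STAGE: an isolated point tower over a maximal origin of characteristic `p` has NO free-rational
tail starting at a hypersurface stage.** Data: `(T, pt)` with `IsMaximalOrigin p 3 ν (T.X 0) (pt 0)` and `IsIsoPointTower 3 ν T pt`; a stage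
`n₀` from which on every step is rational and non-satellite; and a hypersurface presentation of `𝒪_{X_{n₀},x_{n₀}}` adapted to the tail:
`R` regular local of characteristic `p` with `emb.dim R = 4`, a regular system of parameters `x` whose `x 0 = t` is the exceptional equation
of the first step (hypothesis (FREE)₀ in res-type-071's `stalkCongr` form — it holds at SOME index by `EmbeddedStep.exists_index_forall_dvd`,
re-index the r.s.p. accordingly), `σ : R ↠ 𝒪`, `ker σ = (h)`, `h ∈ 𝔪^m ∖ 𝔪^{m+1}`. Conclusion: `False`. Proof: res-D-pv-010's
`FormalFrame.exists_frameTower_arc_of_charP` on the shifted tower `T.drop n₀` (centres, closedness, `π_n x_{n+1} = x_n` from the tower datum;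
`H^{(0)}` constant along the tower by H1 `hilbertSamuelFun_stalk_eq_of_isIsoPointTower`) produces the arc `(Ψ, ψ₀, c, hhP)`;
`false_of_isIsoPointTower_of_hypersurfaceStage_of_arc` (rev 1) concludes. [OURS · L1 W4.2; AI-written]
[cite: CossartPiltant2009, ch. 3 I.9] [cite: CossartJannsenSaito2020, Def. 13.3] -/
theorem false_of_isIsoPointTower_of_freeRationalTail_of_hypersurfaceStage {p : ℕ} [Fact p.Prime] {ν : ℕ → ℕ}
    {T : BlowupTower.{u}} {pt : ∀ n, T.X n} (hO : IsMaximalOrigin p 3 ν (T.X 0) (pt 0)) (hT : IsIsoPointTower 3 ν T pt) (n₀ : ℕ)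
    (htail : ∀ n, n₀ ≤ n → IdeasL1C5.IsRationalStep T pt n ∧ ¬ IdeasL1C5.IsSatelliteStep T pt n)
    {R : Type u} [CommRing R] [IsRegularLocalRing R] [CharP R p] (hd : (maximalIdeal R).spanFinrank = 4)
    (x : Fin 4 → R) (hx : Ideal.span (Set.range x) = maximalIdeal R)
    (σ : R →+* (T.X n₀).presheaf.stalk (pt n₀)) (hσ : Function.Surjective σ) {h : R}
    (hker : RingHom.ker σ = Ideal.span {h}) {m : ℕ} (hm : h ∈ maximalIdeal R ^ m) (hm' : h ∉ maximalIdeal R ^ (m + 1))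
    (hfree : ∀ k, ((T.π n₀).stalkMap (pt (n₀ + 1))).hom (((T.X n₀).presheaf.stalkCongr (.of_eq (hT.2.1 n₀))).inv (σ (x 0))) ∣
      ((T.π n₀).stalkMap (pt (n₀ + 1))).hom (((T.X n₀).presheaf.stalkCongr (.of_eq (hT.2.1 n₀))).inv (σ (x k)))) :
    False := by
  -- the shifted tower `X_{n₀} ← X_{n₀+1} ← ⋯` with its marked points
  have hH : ∀ n, hilbertSamuelFun (((T.drop n₀).X (n + 1)).presheaf.stalk (pt (n₀ + (n + 1)))) 0 =
      hilbertSamuelFun (((T.drop n₀).X n).presheaf.stalk (pt (n₀ + n))) 0 := fun n =>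
    (hilbertSamuelFun_stalk_eq_of_isIsoPointTower hO hT (n₀ + (n + 1)) 0).trans
      (hilbertSamuelFun_stalk_eq_of_isIsoPointTower hO hT (n₀ + n) 0).symm
  obtain ⟨Ψ, ψ₀, c, hψ₀, -, hhP⟩ :=
    IdeasL1C5.FormalFrame.exists_frameTower_arc_of_charP (T.drop n₀) (fun n => pt (n₀ + n)) (fun n => hT.1 (n₀ + n))
      (fun n => hT.2.2.1 (n₀ + n)) (fun n => hT.2.1 (n₀ + n)) (fun n => (htail (n₀ + n) (Nat.le_add_right n₀ n)).1)
      (fun n => (htail (n₀ + n) (Nat.le_add_right n₀ n)).2) hH p hd x hx σ hσ hker hm hm' hfree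
  exact false_of_isIsoPointTower_of_hypersurfaceStage_of_arc hO hT n₀ hd σ hσ hker hm' Ψ ψ₀ hψ₀ c hhP

/-! ## rev 3 — the K1 hypersurface cell from a BARE hypersurface presentation (no chosen coordinates): the regular system of
parameters and the exceptional index are produced inside (tree `exists_regularSystemOfParameters`, res-type-071's
`EmbeddedStep.exists_stalk_presentation_tower` clause (10), a `Fin 4` swap) -/

/-- **K1 AT A HYPERSURFACE STAGE, bare presentation.** As `false_of_isIsoPointTower_of_freeRationalTail_of_hypersurfaceStage`, but the
stage-`n₀` datum is only: `R` regular local of characteristic `p` with `emb.dim R = 4` and `σ : R ↠ 𝒪_{X_{n₀},x_{n₀}}` with `ker σ = (h)`,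
`h ∈ 𝔪^m ∖ 𝔪^{m+1}` — no regular system of parameters and no (FREE)₀ hypothesis: a regular system of parameters exists
(`exists_regularSystemOfParameters`), the first step of the tail lies in the chart of SOME parameter `c_j` (clause (10) of res-type-071's
`EmbeddedStep.exists_stalk_presentation_tower`), and swapping `c_0 ↔ c_j` puts (FREE)₀ at index `0`. [OURS · L1 W4.2; AI-written]
[cite: CossartPiltant2008, proof of Lemma 4.3 (3)] [cite: CossartPiltant2009, ch. 3 I.9] -/
theorem false_of_isIsoPointTower_of_freeRationalTail_of_hypersurfacePresentation {p : ℕ} [Fact p.Prime] {ν : ℕ → ℕ}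
    {T : BlowupTower.{u}} {pt : ∀ n, T.X n} (hO : IsMaximalOrigin p 3 ν (T.X 0) (pt 0)) (hT : IsIsoPointTower 3 ν T pt) (n₀ : ℕ)
    (htail : ∀ n, n₀ ≤ n → IdeasL1C5.IsRationalStep T pt n ∧ ¬ IdeasL1C5.IsSatelliteStep T pt n)
    {R : Type u} [CommRing R] [IsRegularLocalRing R] [CharP R p] (hd : (maximalIdeal R).spanFinrank = 4)
    (σ : R →+* (T.X n₀).presheaf.stalk (pt n₀)) (hσ : Function.Surjective σ) {h : R}
    (hker : RingHom.ker σ = Ideal.span {h}) {m : ℕ} (hm : h ∈ maximalIdeal R ^ m) (hm' : h ∉ maximalIdeal R ^ (m + 1)) :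
    False := by
  -- a regular system of parameters `c : Fin 4 → R`
  obtain ⟨c₀, hc₀⟩ := exists_regularSystemOfParameters (R := R)
  let c : Fin 4 → R := c₀ ∘ finCongr hd.symm
  have hc : Ideal.span (Set.range c) = maximalIdeal R := by
    rw [(finCongr hd.symm).surjective.range_comp]; exact hc₀
  -- the first step of the tail lies in the `c_j`-chart for some `j` (clause (10) of the embedded step at stage `n₀`)
  obtain ⟨j, 𝔔, h', σ', -, -, -, -, -, -, -, -, -, h10, -, -⟩ :=
    IdeasL1C5.EmbeddedStep.exists_stalk_presentation_tower T pt n₀ (hT.1 n₀) (hT.2.2.1 n₀) (hT.2.1 n₀) hd c hc σ hσ hker hm hm'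
  have hfree : ∀ k, ((T.π n₀).stalkMap (pt (n₀ + 1))).hom (((T.X n₀).presheaf.stalkCongr (.of_eq (hT.2.1 n₀))).inv (σ (c j))) ∣
      ((T.π n₀).stalkMap (pt (n₀ + 1))).hom (((T.X n₀).presheaf.stalkCongr (.of_eq (hT.2.1 n₀))).inv (σ (c k))) :=
    fun k => ⟨_, by rw [mul_comm]; exact (h10 k).symm⟩
  -- swap `c_0 ↔ c_j`
  let x : Fin 4 → R := c ∘ Equiv.swap 0 j
  have hx : Ideal.span (Set.range x) = maximalIdeal R := by
    rw [(Equiv.swap (0 : Fin 4) j).surjective.range_comp]; exact hc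
  refine false_of_isIsoPointTower_of_freeRationalTail_of_hypersurfaceStage hO hT n₀ htail hd x hx σ hσ hker hm hm' fun k => ?_
  show ((T.π n₀).stalkMap (pt (n₀ + 1))).hom (((T.X n₀).presheaf.stalkCongr (.of_eq (hT.2.1 n₀))).inv (σ (c (Equiv.swap 0 j 0)))) ∣
      ((T.π n₀).stalkMap (pt (n₀ + 1))).hom (((T.X n₀).presheaf.stalkCongr (.of_eq (hT.2.1 n₀))).inv (σ (c (Equiv.swap 0 j k))))
  rw [Equiv.swap_apply_left]
  exact hfree _

end Summit.ResolutionOfSingularities.ResolutionOfSingularities.Theorems.SigmaMaxModificationsCorridor3.IsoTailsHS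

end
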